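import Mathlib
import HarnessLib

/-!
# Maz'ya's trace inequality for measures of 2-growth in `ℝ³` (`q = 1`, `n = 3`), named fact,
# with the proved passage from test functions to `W^{1,1} ∩ C^∞`

(namespace `Literature.Analysis.FunctionSpaces`) [topic Analysis/FunctionSpaces]

NAMED FACT (unproved here, used as a hypothesis downstream):

* `MazyaTraceD` — V. G. Maz'ya, *Sobolev Spaces*, Springer Series in Soviet Mathematics (1985) [Mazja1985],
  §1.4.2, **Theorem 2**, displays (11)–(12), combined with §1.4.2 Theorem 1, display (2), in the case
  `q = 1`, `n = 3`, `μ = g dx`: there is an absolute constant `c` such that, whenever a non-negative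
  measurable density `g` on `ℝ³` satisfies the 2-growth condition `∫_{B(x,r)} g ≤ K r²` for all balls
  (`BallGrowthTwo g K`), then `∫ g |w| dx ≤ c · K · ∫ |∇w| dx` for every smooth compactly supported `w`.
  (Maz'ya states `μ(E) ≤ K · H^{n-1}`-type growth on all Borel sets of diameter-controlled balls ⇔ the trace
  embedding `𝒟 ⊂ W¹₁ → L₁(μ)`; for `w ∈ BV` this is Meyers–Ziemer, Amer. J. Math. 99 (1977) 1345–1360.  The proof
  needs the co-area formula / Gustin boxing inequality, absent from Mathlib, hence the named-fact status.)

PROVED here (0 `sorry`):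

* `mazyaTrace_integrable_of_D` — from `MazyaTraceD`, the same inequality for smooth `w ∈ L¹` (no compact
  support), by the cut-off `mazyaCutoff R x = χ(x/R)` (`χ` a fixed
  `ContDiffBump`), the product rule `‖∇(χ_R w)‖ ≤ ‖∇w‖ + (C₁/R)|w|`, and monotone convergence over the balls
  `B(0,R)`, `R → ∞` (`ENNReal.le_of_forall_pos_le_add`, `lintegral_iSup`).

Used by `Summits/NavierStokesRegularity/…/Theorems/L3TimeExponentPincerJawFullMorrey.lean` (theorem J′: scaled-energy
Type-I Navier–Stokes solutions are in `L⁶_t L³_x`).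
-/

noncomputable section

namespace Literature.Analysis.FunctionSpaces

open MeasureTheory Set Function Filter Metric Topology
open scoped ENNReal NNReal

/-! ### Statements -/

/-- 2-growth of the measure `g dx` on `ℝ³`: `∫_{B(x,r)} g ≤ K r²` for every ball — the hypothesis of Maz'ya's
trace theorem (growth of `μ` on balls, exponent `s = n - 1 = 2`). -/
@[cite "Mazja1985" "§1.4.2, Theorem 1 condition (2) / Theorem 2 (12): sup_{x,r} r^{-s} μ(B(x,r)), s = 2, n = 3, μ = g dx"]
def BallGrowthTwo (g : (EuclideanSpace ℝ (Fin 3)) → ℝ≥0∞) (K : ℝ≥0) : Prop :=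
  ∀ x : (EuclideanSpace ℝ (Fin 3)), ∀ r : ℝ, 0 < r → ∫⁻ y in ball x r, g y ≤ (K : ℝ≥0∞) * ENNReal.ofReal (r ^ 2)

/-- **Maz'ya's trace inequality**, `𝒟((EuclideanSpace ℝ (Fin 3)))` form, `q = 1`, `n = 3`, for measures `μ = g dx`:
there is an absolute `c` with `∫ g |w| ≤ c · K · ∫ |∇w|` for every smooth compactly supported `w`
whenever `∫_{B(x,r)} g ≤ K r²` for all balls.
[Mazja1985: Maz'ya, *Sobolev Spaces* (Springer 1985), §1.4.2, Theorem 2 (11)–(12) with Theorem 1 (2);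
Meyers–Ziemer, Amer. J. Math. 99 (1977) for `BV`] -/
@[cite "Mazja1985" "§1.4.2, Theorem 2 (11)–(12) with Theorem 1 (2); q = 1, n = 3, μ = g dx"]
def MazyaTraceD : Prop :=
  ∃ c : ℝ≥0, ∀ (g : (EuclideanSpace ℝ (Fin 3)) → ℝ≥0∞), Measurable g → ∀ K : ℝ≥0, BallGrowthTwo g K →
    ∀ (w : (EuclideanSpace ℝ (Fin 3)) → ℝ), ContDiff ℝ (⊤ : ℕ∞) w → HasCompactSupport w →
      ∫⁻ x, g x * ‖w x‖ₑ ≤ (c : ℝ≥0∞) * K * ∫⁻ x, ‖fderiv ℝ w x‖ₑ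


/-! ### Density step `𝒟((EuclideanSpace ℝ (Fin 3))) → W^{1,1} ∩ C^∞` (proved) -/

/-- a fixed smooth mazyaCutoff: `= 1` on `B̄(0,1)`, supported in `B̄(0,2)`. -/
@[folklore] private def mazyaBump : ContDiffBump (0 : (EuclideanSpace ℝ (Fin 3))) := ⟨1, 2, one_pos, one_lt_two⟩

/-- The unit bump `mazyaBump` has a globally bounded derivative. -/
@[folklore] private theorem exists_fderiv_mazyaBump_bound :
    ∃ C₁ : ℝ, 0 ≤ C₁ ∧ ∀ x : (EuclideanSpace ℝ (Fin 3)), ‖fderiv ℝ (mazyaBump : (EuclideanSpace ℝ (Fin 3)) → ℝ) x‖ ≤ C₁ := by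
  have hc : Continuous (fderiv ℝ (mazyaBump : (EuclideanSpace ℝ (Fin 3)) → ℝ)) :=
    (mazyaBump.contDiff (n := 1)).continuous_fderiv one_ne_zero
  have hs : HasCompactSupport (fderiv ℝ (mazyaBump : (EuclideanSpace ℝ (Fin 3)) → ℝ)) := mazyaBump.hasCompactSupport.fderiv (𝕜 := ℝ)
  obtain ⟨C, hC⟩ := hc.bounded_above_of_compact_support hs
  exact ⟨max C 0, le_max_right _ _, fun x => (hC x).trans (le_max_left _ _)⟩

/-- the rescaled mazyaCutoff `χ_R(x) = mazyaBump(x/R)`. -/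
@[folklore] private def mazyaCutoff (R : ℝ) (x : (EuclideanSpace ℝ (Fin 3))) : ℝ := mazyaBump (R⁻¹ • x)

/-- The rescaled cut-off `mazyaCutoff R` is smooth. -/
@[folklore] private theorem mazyaCutoff_contDiff {R : ℝ} {n : ℕ∞} : ContDiff ℝ n (mazyaCutoff R) := by
  have h : ContDiff ℝ n (fun y : (EuclideanSpace ℝ (Fin 3)) => R⁻¹ • y) := contDiff_id.const_smul R⁻¹
  exact (mazyaBump.contDiff).comp h

/-- `mazyaCutoff R = 1` on the closed ball of radius `R`. -/
@[folklore] private theorem mazyaCutoff_eq_one {R : ℝ} (hR : 0 < R) {x : (EuclideanSpace ℝ (Fin 3))} (hx : ‖x‖ ≤ R) : mazyaCutoff R x = 1 := by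
  unfold mazyaCutoff
  apply mazyaBump.one_of_mem_closedBall
  rw [mem_closedBall, dist_zero_right, norm_smul, norm_inv, Real.norm_eq_abs, abs_of_pos hR]
  rw [show mazyaBump.rIn = 1 from rfl, inv_mul_le_iff₀ hR]
  simpa using hx

/-- `mazyaCutoff R = 0` outside the ball of radius `2R`. -/
@[folklore] private theorem mazyaCutoff_eq_zero {R : ℝ} (hR : 0 < R) {x : (EuclideanSpace ℝ (Fin 3))} (hx : 2 * R ≤ ‖x‖) : mazyaCutoff R x = 0 := by
  unfold mazyaCutoff
  apply mazyaBump.zero_of_le_dist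
  rw [dist_zero_right, norm_smul, norm_inv, Real.norm_eq_abs, abs_of_pos hR,
    show mazyaBump.rOut = 2 from rfl, le_inv_mul_iff₀ hR]
  linarith

/-- `mazyaCutoff R ≥ 0`. -/
@[folklore] private theorem mazyaCutoff_nonneg (R : ℝ) (x : (EuclideanSpace ℝ (Fin 3))) : 0 ≤ mazyaCutoff R x := mazyaBump.nonneg
/-- `mazyaCutoff R ≤ 1`. -/
@[folklore] private theorem mazyaCutoff_le_one (R : ℝ) (x : (EuclideanSpace ℝ (Fin 3))) : mazyaCutoff R x ≤ 1 := mazyaBump.le_one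

/-- `mazyaCutoff R · w` has compact support. -/
@[folklore] private theorem hasCompactSupport_mazyaCutoff_mul {R : ℝ} (hR : 0 < R) (w : (EuclideanSpace ℝ (Fin 3)) → ℝ) :
    HasCompactSupport (fun x => mazyaCutoff R x * w x) := by
  refine HasCompactSupport.intro (isCompact_closedBall (0 : (EuclideanSpace ℝ (Fin 3))) (2 * R)) fun x hx => ?_
  rw [mem_closedBall, dist_zero_right, not_le] at hx
  rw [mazyaCutoff_eq_zero hR hx.le, zero_mul]

/-- `‖∇(mazyaCutoff R)‖ ≤ C₁ / R`. -/
@[folklore] private theorem norm_fderiv_mazyaCutoff_le {C₁ : ℝ} (hC₁ : ∀ x : (EuclideanSpace ℝ (Fin 3)), ‖fderiv ℝ (mazyaBump : (EuclideanSpace ℝ (Fin 3)) → ℝ) x‖ ≤ C₁)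
    {R : ℝ} (hR : 0 < R) (x : (EuclideanSpace ℝ (Fin 3))) : ‖fderiv ℝ (mazyaCutoff R) x‖ ≤ C₁ / R := by
  have h1 : HasFDerivAt (fun y : (EuclideanSpace ℝ (Fin 3)) => R⁻¹ • y) (R⁻¹ • ContinuousLinearMap.id ℝ (EuclideanSpace ℝ (Fin 3))) x :=
    (hasFDerivAt_id x).const_smul R⁻¹
  have h2 : HasFDerivAt (mazyaBump : (EuclideanSpace ℝ (Fin 3)) → ℝ) (fderiv ℝ (mazyaBump : (EuclideanSpace ℝ (Fin 3)) → ℝ) (R⁻¹ • x)) (R⁻¹ • x) :=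
    ((mazyaBump.contDiff (n := 1)).differentiable one_ne_zero).differentiableAt.hasFDerivAt
  have h3 : HasFDerivAt (mazyaCutoff R) ((fderiv ℝ (mazyaBump : (EuclideanSpace ℝ (Fin 3)) → ℝ) (R⁻¹ • x)).comp
      (R⁻¹ • ContinuousLinearMap.id ℝ (EuclideanSpace ℝ (Fin 3)))) x := h2.comp x h1
  rw [h3.fderiv]
  calc ‖(fderiv ℝ (mazyaBump : (EuclideanSpace ℝ (Fin 3)) → ℝ) (R⁻¹ • x)).comp (R⁻¹ • ContinuousLinearMap.id ℝ (EuclideanSpace ℝ (Fin 3)))‖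
      ≤ ‖fderiv ℝ (mazyaBump : (EuclideanSpace ℝ (Fin 3)) → ℝ) (R⁻¹ • x)‖ * ‖R⁻¹ • ContinuousLinearMap.id ℝ (EuclideanSpace ℝ (Fin 3))‖ :=
        ContinuousLinearMap.opNorm_comp_le _ _
    _ ≤ C₁ * R⁻¹ := by
        gcongr
        · exact (norm_nonneg _).trans (hC₁ 0)
        · exact hC₁ _
        · rw [norm_smul, norm_inv, Real.norm_eq_abs, abs_of_pos hR]
          exact mul_le_of_le_one_right (by positivity) ContinuousLinearMap.norm_id_le
    _ = C₁ / R := by rw [div_eq_mul_inv]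

/-- gradient of the cut-off function: `|∇(χ_R w)| ≤ |∇w| + (C₁/R)|w|`. -/
@[folklore] private theorem enorm_fderiv_mazyaCutoff_mul_le {C₁ : ℝ} (hC₁0 : 0 ≤ C₁)
    (hC₁ : ∀ x : (EuclideanSpace ℝ (Fin 3)), ‖fderiv ℝ (mazyaBump : (EuclideanSpace ℝ (Fin 3)) → ℝ) x‖ ≤ C₁) {R : ℝ} (hR : 0 < R) {w : (EuclideanSpace ℝ (Fin 3)) → ℝ}
    (hw : ContDiff ℝ (⊤ : ℕ∞) w) (x : (EuclideanSpace ℝ (Fin 3))) :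
    ‖fderiv ℝ (fun y => mazyaCutoff R y * w y) x‖ₑ ≤
      ‖fderiv ℝ w x‖ₑ + ENNReal.ofReal (C₁ / R) * ‖w x‖ₑ := by
  have hχd : DifferentiableAt ℝ (mazyaCutoff R) x :=
    ((mazyaCutoff_contDiff (R := R) (n := 1)).differentiable one_ne_zero).differentiableAt
  have hwd : DifferentiableAt ℝ w x :=
    ((hw.of_le (by exact_mod_cast le_top) : ContDiff ℝ 1 w).differentiable one_ne_zero).differentiableAt
  have hder : fderiv ℝ (fun y => mazyaCutoff R y * w y) x =
      mazyaCutoff R x • fderiv ℝ w x + w x • fderiv ℝ (mazyaCutoff R) x := by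
    show fderiv ℝ (mazyaCutoff R * w) x = _
    rw [fderiv_mul hχd hwd]
  rw [hder]
  have hreal : ‖mazyaCutoff R x • fderiv ℝ w x + w x • fderiv ℝ (mazyaCutoff R) x‖ ≤
      ‖fderiv ℝ w x‖ + C₁ / R * ‖w x‖ := by
    calc ‖mazyaCutoff R x • fderiv ℝ w x + w x • fderiv ℝ (mazyaCutoff R) x‖
        ≤ ‖mazyaCutoff R x • fderiv ℝ w x‖ + ‖w x • fderiv ℝ (mazyaCutoff R) x‖ := norm_add_le _ _
      _ ≤ ‖fderiv ℝ w x‖ + C₁ / R * ‖w x‖ := by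
          rw [norm_smul, norm_smul, Real.norm_eq_abs (mazyaCutoff R x),
            abs_of_nonneg (mazyaCutoff_nonneg R x)]
          refine add_le_add ?_ ?_
          · exact mul_le_of_le_one_left (norm_nonneg _) (mazyaCutoff_le_one R x)
          · rw [mul_comm]
            exact mul_le_mul_of_nonneg_right (norm_fderiv_mazyaCutoff_le hC₁ hR x) (norm_nonneg _)
  calc ‖mazyaCutoff R x • fderiv ℝ w x + w x • fderiv ℝ (mazyaCutoff R) x‖ₑ
      = ENNReal.ofReal ‖mazyaCutoff R x • fderiv ℝ w x + w x • fderiv ℝ (mazyaCutoff R) x‖ :=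
        (ofReal_norm _).symm
    _ ≤ ENNReal.ofReal (‖fderiv ℝ w x‖ + C₁ / R * ‖w x‖) := ENNReal.ofReal_le_ofReal hreal
    _ = ‖fderiv ℝ w x‖ₑ + ENNReal.ofReal (C₁ / R) * ‖w x‖ₑ := by
        rw [ENNReal.ofReal_add (norm_nonneg _) (by positivity), ofReal_norm,
          ENNReal.ofReal_mul (by positivity), ofReal_norm]

/-- **Density step (proved): Maz'ya's trace inequality for smooth integrable functions.**  From the
test-function form `MazyaTraceD`, the same inequality (same constant) for every smooth `w ∈ L¹`
(if `∇w ∉ L¹` the right-hand side is `∞`): cut off with `χ(x/R)`, let `R → ∞`. -/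
@[cite "Mazja1985" "§1.4.2, Theorem 2 (11) for u ∈ W¹₁ ∩ C^∞ instead of u ∈ 𝒟 (density, §1.1.5); our proof of the passage"]
theorem mazyaTrace_integrable_of_D (h : MazyaTraceD) :
    ∃ c : ℝ≥0, ∀ (g : (EuclideanSpace ℝ (Fin 3)) → ℝ≥0∞), Measurable g → ∀ K : ℝ≥0, BallGrowthTwo g K →
      ∀ (w : (EuclideanSpace ℝ (Fin 3)) → ℝ), ContDiff ℝ (⊤ : ℕ∞) w → Integrable w volume →
        ∫⁻ x, g x * ‖w x‖ₑ ≤ (c : ℝ≥0∞) * K * ∫⁻ x, ‖fderiv ℝ w x‖ₑ := by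
  obtain ⟨c, hc⟩ := h
  obtain ⟨C₁, hC₁0, hC₁⟩ := exists_fderiv_mazyaBump_bound
  refine ⟨c, fun g hg K hK w hw hwi => ?_⟩
  set A : ℝ≥0∞ := ∫⁻ x, ‖fderiv ℝ w x‖ₑ with hA
  set E : ℝ≥0∞ := ∫⁻ x, ‖w x‖ₑ with hE
  have hEtop : E < ⊤ := hwi.2
  have hwm : Measurable fun x => ‖w x‖ₑ := (hw.continuous.measurable).enorm
  have hdm : Measurable fun x => ‖fderiv ℝ w x‖ₑ :=
    ((hw.continuous_fderiv (by simp)).measurable).enorm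
  -- the cut-off inequality at radius `R`
  have hcut : ∀ R : ℝ, 0 < R → ∫⁻ x in ball 0 R, g x * ‖w x‖ₑ ≤
      (c : ℝ≥0∞) * K * (A + ENNReal.ofReal (C₁ / R) * E) := by
    intro R hR
    have hwR : ContDiff ℝ (⊤ : ℕ∞) (fun y => mazyaCutoff R y * w y) := mazyaCutoff_contDiff.mul hw
    have h1 := hc g hg K hK _ hwR (hasCompactSupport_mazyaCutoff_mul hR w)
    calc ∫⁻ x in ball 0 R, g x * ‖w x‖ₑ
        = ∫⁻ x in ball 0 R, g x * ‖mazyaCutoff R x * w x‖ₑ := by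
          refine setLIntegral_congr_fun measurableSet_ball fun x hx => ?_
          rw [mem_ball, dist_zero_right] at hx
          rw [mazyaCutoff_eq_one hR hx.le, one_mul]
      _ ≤ ∫⁻ x, g x * ‖mazyaCutoff R x * w x‖ₑ := setLIntegral_le_lintegral _ _
      _ ≤ (c : ℝ≥0∞) * K * ∫⁻ x, ‖fderiv ℝ (fun y => mazyaCutoff R y * w y) x‖ₑ := h1
      _ ≤ (c : ℝ≥0∞) * K * ∫⁻ x, (‖fderiv ℝ w x‖ₑ + ENNReal.ofReal (C₁ / R) * ‖w x‖ₑ) := by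
          gcongr with x
          exact enorm_fderiv_mazyaCutoff_mul_le hC₁0 hC₁ hR hw x
      _ = (c : ℝ≥0∞) * K * (A + ENNReal.ofReal (C₁ / R) * E) := by
          rw [lintegral_add_left hdm, lintegral_const_mul _ hwm]
  -- each ball integral is `≤ c K A`
  have hball : ∀ n : ℕ, ∫⁻ x in ball 0 ((n : ℝ) + 1), g x * ‖w x‖ₑ ≤ (c : ℝ≥0∞) * K * A := by
    intro n
    refine ENNReal.le_of_forall_pos_le_add fun ε hε _ => ?_
    -- the error term `X / R` with `X = c K C₁ E < ⊤`; choose `R ≥ n+1` with `X ≤ ε R`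
    set X : ℝ≥0∞ := (c : ℝ≥0∞) * K * (ENNReal.ofReal C₁ * E) with hX
    have hXtop : X ≠ ⊤ :=
      ENNReal.mul_ne_top (ENNReal.mul_ne_top ENNReal.coe_ne_top ENNReal.coe_ne_top)
        (ENNReal.mul_ne_top ENNReal.ofReal_ne_top hEtop.ne)
    set x' : ℝ := X.toReal with hx'
    have hXeq : X = ENNReal.ofReal x' := (ENNReal.ofReal_toReal hXtop).symm
    have hx'0 : 0 ≤ x' := ENNReal.toReal_nonneg
    have hεpos : (0 : ℝ) < ε := by exact_mod_cast hε
    set R : ℝ := max ((n : ℝ) + 1) ((x' + 1) / ε) with hRdef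
    have hRpos : 0 < R := lt_max_of_lt_left (by positivity)
    have hRn : (n : ℝ) + 1 ≤ R := le_max_left _ _
    have hRε : (x' + 1) / ε ≤ R := le_max_right _ _
    have hXR : X ≤ ENNReal.ofReal R * ε := by
      rw [hXeq, ← ENNReal.ofReal_coe_nnreal, ← ENNReal.ofReal_mul hRpos.le]
      apply ENNReal.ofReal_le_ofReal
      have : (x' + 1) / (ε : ℝ) * ε ≤ R * ε := mul_le_mul_of_nonneg_right hRε hεpos.le
      rw [div_mul_cancel₀ _ hεpos.ne'] at this
      linarith
    calc ∫⁻ x in ball 0 ((n : ℝ) + 1), g x * ‖w x‖ₑ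
        ≤ ∫⁻ x in ball 0 R, g x * ‖w x‖ₑ := lintegral_mono_set (ball_subset_ball hRn)
      _ ≤ (c : ℝ≥0∞) * K * (A + ENNReal.ofReal (C₁ / R) * E) := hcut R hRpos
      _ = (c : ℝ≥0∞) * K * A + (ENNReal.ofReal R)⁻¹ * X := by
          rw [hX, mul_add, ENNReal.ofReal_div_of_pos hRpos, div_eq_mul_inv]
          ring
      _ ≤ (c : ℝ≥0∞) * K * A + (ENNReal.ofReal R)⁻¹ * (ENNReal.ofReal R * ε) := by gcongr
      _ = (c : ℝ≥0∞) * K * A + ε := by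
          rw [← mul_assoc, ENNReal.inv_mul_cancel ((ENNReal.ofReal_pos.2 hRpos).ne')
            ENNReal.ofReal_ne_top, one_mul]
  -- monotone convergence over the exhausting balls
  have hmono : Monotone fun n : ℕ => (ball (0 : (EuclideanSpace ℝ (Fin 3))) ((n : ℝ) + 1)).indicator (fun x => g x * ‖w x‖ₑ) := by
    intro n m hnm x
    have hnm' : (n : ℝ) ≤ m := by exact_mod_cast hnm
    exact indicator_le_indicator_of_subset (ball_subset_ball (by linarith)) (fun _ => bot_le) x
  have hsup : (fun x => g x * ‖w x‖ₑ) =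
      fun x => ⨆ n : ℕ, (ball (0 : (EuclideanSpace ℝ (Fin 3))) ((n : ℝ) + 1)).indicator (fun x => g x * ‖w x‖ₑ) x := by
    funext x
    apply le_antisymm
    · obtain ⟨n, hn⟩ := exists_nat_gt ‖x‖
      have hx : x ∈ ball (0 : (EuclideanSpace ℝ (Fin 3))) ((n : ℝ) + 1) := by
        rw [mem_ball, dist_zero_right]; linarith
      exact le_iSup_of_le n (by rw [indicator_of_mem hx])
    · exact iSup_le fun n => indicator_le_self _ _ x
  calc ∫⁻ x, g x * ‖w x‖ₑ
      = ∫⁻ x, ⨆ n : ℕ, (ball (0 : (EuclideanSpace ℝ (Fin 3))) ((n : ℝ) + 1)).indicator (fun x => g x * ‖w x‖ₑ) x :=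
        lintegral_congr fun x => congrFun hsup x
    _ = ⨆ n : ℕ, ∫⁻ x, (ball (0 : (EuclideanSpace ℝ (Fin 3))) ((n : ℝ) + 1)).indicator (fun x => g x * ‖w x‖ₑ) x :=
        lintegral_iSup (fun n => (hg.mul hwm).indicator measurableSet_ball) hmono
    _ ≤ (c : ℝ≥0∞) * K * A := by
        refine iSup_le fun n => ?_
        rw [lintegral_indicator measurableSet_ball]
        exact hball n

end Literature.Analysis.FunctionSpaces

end
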